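import Mathlib
import HarnessLib
import HarnessLib.Audit
import Summits.MatrixMultiplication.Statement
import Literature.Barriers.MatrixMultiplication.NormalizerBarrier
import Literature.RepresentationTheory.FiniteGroups.CharacterDegrees
import Literature.NumberTheory.DiophantineGeometry.PartitionTableaux
import Literature.Computability.AlgebraicComplexity.FlatteningBound
import HarnessLib.Audit.Status.Attr

/-!
Route: LevelGradedCohnUmans

# Route LevelGradedCohnUmans — pay only for the irreps your tests see — graded Cohn–Umans designs
(S_n token levels, GL_n(F_q) Fourier rank) under the quasirandom radar

X = GRADED DESIGN FAMILY ("it suffices to show"; realises card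
level-graded-cohn-umans-under-the-radar). A Cohn–Umans algorithm in a finite group G reads the
product Â·B̂ (Â = Σ A_xy x⁻¹y, B̂ = Σ B_y'z y'⁻¹z) through one test functional f_(x₀,z₀) : G → ℂ per
output entry; call (X,Y,Z) J-SEPARATED for a bi-invariant subspace J ≤ ℂ^G of tests if for every
(x₀,z₀) some f ∈ J has f(x⁻¹ y y'⁻¹ z) = [x = x₀ ∧ y = y' ∧ z = z₀] on all of X×Y×Y×Z (TPP at the
target plus BCGPU24's separation, Def. 2.1, p. 10 of the held text). X: for every ε > 0 there are a
finite group G, a bi-invariant J and a J-separated triple whose volume beats the GRADED budget at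
exponent 2+ε, Σ_(χ ∈ Irr(G), χ ∈ J) χ(1)^(2+ε) < (|X||Y||Z|)^((2+ε)/3) — one pays only for the
irreducibles whose matrix coefficients the tests use, instead of Σ_all d^(2+ε) (the CKSU target;
BCGPU24 Thm 2.2 with R_sep ⊊ Irr G, whose finite-group use the authors call "conceivable", p. 4, and
never set up).
THE TWO ENGINES ARE ONE OBJECT (frame duality, crux chain 2026-08-16): in S_n the k-token tests f(g)
= Σ_p c_p(g∘p) and in GL_m(F_p) the Fourier-rank-≤k tests f(g) = Σ_(rk M ≤ k) c_M ψ(tr(Mg)) are both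
the coefficient space of the PERMUTATION MODULE ON k-FRAMES (k points of [n], resp. the matrix–frame
products g·U, U ∈ M_(m×k)(F_p)); the priced irreducibles are λ₁ ≥ n−k (Young's rule) resp. the
Harish-Chandra series through GL_j × GL_(m−j), j ≤ k; a design is an incidence configuration with an
exact numeric target, the wall D = dim J (graded Neumann count: V ≤ 0.385·D^(3/2), tree) against the
budget Σ_J d^(2+ε). The S_n engine has N_eff = (Σd²)³/(Σd³)² bounded at each level (hence the
level-2 rung LevelTwoBeatsCubes is REFUTED and k must → ∞), the Lie engine has N_eff ≈ p^k → ∞ at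
FIXED (m,k) — so there wall-saturation up to ANY constant already gives every ε (kernel-checked for
(m,k) = (2,1): LevelOneLink).
TWO LEVERS make the Lie engine attackable (both kernel-checked as glue, rev 7): (L1) SUBGROUP
IDENTITY TEST — for subgroup triples H₁,H₂,H₃ ≤ GL_m(F_p), graded separation ⇔ subgroup TPP ∧ ONE
rank-≤k test f with f(1) = 1, f = 0 on H₁H₂H₃∖{1} (bi-invariance moves every target to the identity;
crux SubgroupIdentityDesigns, link SubgroupIdentityLink PROVED), with explicit candidates: the Borel
template H₁ = S₁⋉U⁻_(cols 1..k), H₂ = S₂⋉U⁺_(rows k+1..2k), H₃ = S₃⋉U⁺_(rows 1..k) in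
GL_(k²+3k/2)(F_p), which passes TPP (LDU), the frame-faithfulness filter, the three walls and the
graded Neumann count at V = Θ(D^(3/2)/p) by counting, leaving ONE linear statement per k (Id ∉ span
π_k(H₁H₂H₃∖1)); k = 4 in GL_22(F_p) would give ω ≤ 2.4, the k-family gives X; (L2) UNIVERSALITY OF
THE SMALLEST CELL — rank-1-separated triples in GL_2(F_p) with |X|,|Y|,|Z| ≥ c·p^(3/2) for
unboundedly many p give X for every ε (crux LevelOneGL2Designs, link LevelOneLink = the chain's
LieRankDesigns_of_levelOneGL2 + the Mackey budget 1 + p^s + (p−2)(p+1)^s): an additive-combinatorial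
packing problem at |G|^(9/8) in the Borel/torus geometry of GL_2(F_p) with an exact linear oracle.
Lean: `∀ ε : ℝ, 0 < ε → ∃ (G : Type) (_ : Group G) (_ : Fintype G) (J : Submodule ℂ (G → ℂ)) (X Y Z
: Finset G), (∀ f ∈ J, ∀ a b : G, (fun g : G => f (a * g * b)) ∈ J) ∧ (∀ x₀ ∈ X, ∀ z₀ ∈ Z, ∃ f ∈ J,
∀ x ∈ X, ∀ y ∈ Y, ∀ y' ∈ Y, ∀ z ∈ Z, (x = x₀ ∧ y = y' ∧ z = z₀ → f (x⁻¹ * y * y'⁻¹ * z) = 1) ∧ (¬ (x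
= x₀ ∧ y = y' ∧ z = z₀) → f (x⁻¹ * y * y'⁻¹ * z) = 0)) ∧ (∑ᶠ χ ∈
Literature.RepresentationTheory.FiniteGroups.irrChars G ∩ (J : Set (G → ℂ)), (χ 1).re ^ (2 + ε)) <
((X.card * Y.card * Z.card : ℕ) : ℝ) ^ ((2 + ε) / 3)`

## Assembly
Pure ε-bookkeeping, PROVED sorry-free (theorem closes, rendered below; Assembly item has a
refuter-attached candidate proof): if ω := omega ℂ > 2, put ε := ω − 2 > 0; GradedDesignFamily
yields G, J, X, Y, Z with Σ_(χ∈J) χ(1)^ω < (|X||Y||Z|)^(ω/3), while GradedPricing gives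
(|X||Y||Z|)^(ω/3) ≤ Σ_(χ∈J) χ(1)^ω — contradiction; hence ω ≤ 2, and 2 ≤ ω is the tree's
omega_two_le (FlatteningBound), so MatrixMultiplication (= omega ℂ = 2, MatrixMultiplication_iff). X
is fed by kernel-checked support links from four design cruxes: SnEngineLink : SnLevelDesigns → X
and LieEngineLink : LieRankDesigns → X (rev 3/4: package J_k / F_k as bi-invariant submodules;
budgets literal), and, new at rev 7, SubgroupIdentityLink : SubgroupIdentityDesigns → LieRankDesigns
(PROVED in the planner's SketchLinks.lean from the chain's subgroup_rankSeparated_iff, axioms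
propext/choice/Quot.sound) and LevelOneLink : LevelOneGL2Designs → LieRankDesigns (PROVED modulo the
elementary GL_2 level-one budget bound). The exponent-3 milestone LieRankBeatsCubes (an item at rev
6–9: one rank-≤k-separated design in some GL_m(F_p) beating the graded sum of cubes, which would
give ω < 3 under the radar via GradedPricing) is the ε = 1 slice of LieRankDesigns — necessary for
the Lie cruxes, never sufficient for a hypothesis of closes (a fixed-exponent design certifies only
its own exponent; tensor powers preserve it) — so the 2026-08-16 unused-crux repair dropped it as an
item (not refuted); it stays the first rung and cheapest falsifier of the Lie engine inside the
LieRankDesigns / LevelOneGL2Designs crux chains (LevelOneBeatsCubesAt p; artefacts under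
Cruxes/LieRankBeatsCubes/ and Theorems/LieRankBeatsCubes/Negative/). The refuted ex-milestone
LevelTwoBeatsCubes (level 2 of S_n, dropped rev 3) never was a hypothesis either.

Rationale: WHY THIS LINE. BlasiakCohnGrochowPrattUmans2024 Thm 2.2 (held text p. 11; also the form
(|X||Y||Z|)^(ω/3) ≤ D·d_max^(ω−2)) prices a TPP triple by Σ_(ρ∈R_sep) (dim ρ)^ω as soon as
RepFun(R_sep) contains separating functions, and p. 4 calls the finite-group use "conceivable";
nobody set it up. WHY THIS FORM IS EASIER than ω = 2 head-on (X is a sufficient condition, not an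
equivalent): (a) it lands in finite group theory / additive combinatorics with NAMED tools that
closed comparable statements — the Cohn–Umans inequality and its wreath/STPP machinery (CKSU2005 §2
"beating the sum of the cubes", held, ω < 2.9088; §§ on STPP, ω < 2.41), quasirandom mixing
(BCGPU2023 Thm 3.2), the normalizer count (Thm 3.6, tree), product theorems in SL_2(F_p)
(Helfgott2008 Key Proposition, held p. 3), RSK/Kazhdan–Lusztig bases of ℂS_n modulo Young kernels
(RaghavanSamuelSubrahmanyam2009 Thm 2, held), Gauss-sum nonvanishing; (b) it exposes an exact
numeric target per cell (wall D, budget Σ_J d^s, graded Neumann cap ψ(D) = max_t(tD − t³ + t²)) so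
every rung is a FINITE certificate checkable in Lean, and single-rung deaths are theorems, not
opinions (LevelTwoBeatsCubes_refuted); (c) the graded price removes exactly the term that kills Lie
type at full budget (BCGPU2023 Cor 3.4 charges Σ_Irr d^ω; R_k omits the large series) and exactly
the class-number obstruction that kills Young subgroups in S_n (BCCGU2017 Thm 4.2), while the S_n
crux is provably WEAKER than BCCGU2017 §5's open full-budget question (FullBudgetSymmetricDesigns →
SnLevelDesigns, n := k, kernel-checked by two triage seats). THE LEVER (mechanism grade, new on this
problem): frame duality — level-k tests are the coefficient space of the permutation module on
k-frames in BOTH engines (Young's rule ↔ Harish-Chandra series) — plus (L1) the SUBGROUP IDENTITY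
TEST (bi-invariance of F_k collapses the |X||Z| separation conditions of a subgroup triple to ONE
linear condition at the identity; subgroup_rankSeparated_iff PROVED) with the explicit Borel
template family, and (L2) UNIVERSALITY OF FIXED CELLS (N_eff ≈ p^k Harish-Chandra twists of equal
leading degree ⇒ constant-factor wall saturation at one (m,k) proves every ε;
LieRankDesigns_of_levelOneGL2 PROVED). GradedPricing itself is closing: the lead's picked line
fourier-support-repfun has both stubs kernel-checked (Cruxes/GradedPricing/PICKED.md). Imported
areas: representation theory of S_n (Young's rule, RSK/Schensted, EFP level-k spaces, RSS/KL
cellular bases), harmonic analysis on GL_n(F_q) (rank filtration GurevichHowe2017, permutation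
modules on frames, Gelfand–Graev/big-cell spanning), additive combinatorics in GL_2(F_p), the tree's
restriction calculus. Prior routes price at full budget only (GroupTheoreticSTPP, SnThresholdCensus,
SnSubsetDichotomy, OrbitHarmonicsHosts).
RANKED CRUXES. #0 GradedDesignFamily (target) — X as in § Thesis. Why it might fail: J-separated ⇒ V
≤ 0.385·(dim J)^(3/2) (graded Neumann count, tree), so at exponent 2+ε the d²-weighted mean of
(d_ρ/√D)^ε over Irr ∩ J must stay < 0.53 (J needs ≳ e^(1.27/ε) comparable blocks); beating even
exponent 3 with a proper J is open (the exponent-3 rung = the ε = 1 slice of #5, ex-item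
LieRankBeatsCubes). [BlasiakCohnGrochowPrattUmans2024, CohnKleinbergSzegedyUmans2005,
BlasiakChurchCohnGrochowUmans2017]
#2 GradedPricing (crux, M; CLOSED — proved by Theorems.GradedPricing.GradedPricing_of) —
finite-group R_sep form of BCGPU24 Thm 2.2: bi-invariant J, J-separated X,Y,Z ⇒ (|X||Y||Z|)^(ω/3) ≤
Σ_(χ ∈ Irr(G) ∩ J) χ(1)^ω. Attack: J^⊥ ⊴ ℂ[G] two-sided, read-out factors through ℂ[G]/J^⊥ ≅
⊕_(χ_ρ∈J) M_(d_ρ), tensor-power argument; line fourier-support-repfun PICKED, stubs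
stub_support/stub_expansion kernel-checked; Disproof.lean: bi-invariance and the strict 0/1 pattern
are load-bearing (gradedPricing_false_with_leftInv_only). Why it might fail: rendering only ('χ ∈ J'
= 'M_ρ ⊆ J' needs bi-invariance; Sep must imply TPP — SepImpliesTPP).
[BlasiakCohnGrochowPrattUmans2024, CohnUmans2003]
#4 SnLevelDesigns (crux, open-problem; the second engine) — ∀ε ∃ n,k and a k-token-separated triple
in S_n beating Σ_(λ₁ ≥ n−k) f_λ^(2+ε); wall form: γ_k := V^(1/3)/√D_k ≥ k^(−C) along k → ∞ suffices
(PolySlack ⇒ crux via VershikKerov1985_maxCharDegree_holds, PROVED in tree; per-token constant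
losses c^k are fatal, poly(k) losses free). Attack (triage r1, 3 seats: ONE constructive line): the
exact criterion — L_k = {lis ≥ n−k} is a basis of ℂS_n/J_k^⊥ (RaghavanSamuelSubrahmanyam2009 Thm 2
at λ = (n−k,1^k)), KL unitriangular straightening gives Bruhat-shadow certificates (targets in L_k,
no garbage product Bruhat-above a target ⇒ separated), Garnir/cube antisymmetrisers sgn·1_(gK), K ≅
(ℤ/2)^(k+1), generate J_k^⊥ for n ≥ 2k+2 (the complete local obstruction), fixed-set certificates
f_t = G(Fix(t⁻¹g)) as an independent diagonal criterion; verified separated toys V = 90, 204, 345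
(level 2, n = 5,6,7), 600 (level 3, n = 6); first lemma SchenstedInterpolates (RSS Thm 2,
numerically re-derived thrice, n ≤ 8) + card1Shape_holds (kernel-checked). Honest state: no
near-wall family in sight; the open object is a structured middle Y of size ≈ √D_k. Why it might
fail: graded Neumann empties levels ≤ 6 at exponent 3 and each fixed level for ε < 6/k, so witnesses
need k → ∞ with near-extremal graded packings; every naive architecture collapses |Y| (blocking
dichotomy); at k ≥ n−1 it is BCCGU17's open problem. [BlasiakChurchCohnGrochowUmans2017,
EllisFriedgutPilpel2011, RaghavanSamuelSubrahmanyam2009]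
#5 LieRankDesigns (crux, XL; the Lie engine, umbrella of #6/#7; its ε = 1 slice is the exponent-3
rung, ex-item LieRankBeatsCubes, see EX-ITEM below) — ∀ε ∃ p,m,k and a Fourier-rank-≤k-separated
triple in GL_m(F_p) beating Σ_(Irr ∩ F_k) χ(1)^(2+ε). rev 1's Lang-transplant first target is DEAD
numerically (level pinning, card frame-duality-level-pinning: BCGPU24 Thm 3.1's mechanism is
archimedean, Lemma 3.2 pp. 25–26); the live lines are #6 and #7 below plus the siegel-triangle (m =
2k, radical inflation) card; constraints every witness meets: three walls ≤ D_k, graded Neumann,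
pigeonhole |X||Y| + |Y||Z| ≤ |G|, θ∘det-isotropy |X||Z| + |X⁻¹YY⁻¹Z| ≤ |G| for 2k < m
(Disproof.lean), BALANCE (no design set is a union of cosets of a k-frame-transitive subgroup:
Singer tori, SL_m), LEVEL PINNING (V = D_k^(3/2) p^(−ck) proves only ω ≤ 2 + 4c/(3−2c)). Why it
might fail: no level k < m beating even exponent 3 is known; wall-saturation must hold on all three
pairs at once while balance forbids the frame-transitive pieces that pack best; a graded extension
of BCGPU2023 Thm 3.2 would kill it. [BlasiakCohnGrochowPrattUmans2024,
BlasiakCohnGrochowPrattUmans2023, GurevichHowe2017]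
#6 SubgroupIdentityDesigns (crux, NEW rev 7, XL; the mechanism line) — ∀ε ∃ p,m,k and SUBGROUPS
H₁,H₂,H₃ ≤ GL_m(F_p) with the tree's SubgroupTPP, ONE rank-≤k test f with f(1) = 1 and f(abc) = 0
for abc ≠ 1, and Σ_(Irr ∩ F_k) χ(1)^(2+ε) < (|H₁||H₂||H₃|)^((2+ε)/3); ⇒ #5 by SubgroupIdentityLink
(PROVED). Attack = the Borel template (card borel-configuration-identity-test): TPP by LDU
(borelConfig_subgroupTPP PROVED) + toral bookkeeping; filter (N) 'Id ∉ span π_k(H_i∖1)' ⇔ the frame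
module sees every irreducible of H_i — passed by REGULAR frame orbits for H₁, H₃ (H₂'s mixed
irreducibles: first finite task, Clifford/Mackey); walls and graded Neumann met with V =
(p−1)^(k²+3k/2−1) p^(3(mk−k²/2)−k²−3k/2) = Θ(D^(3/2)/p), m = k² + 3k/2; remaining per k: the
identity test Id ∉ A₁A₂°A₃ + A₁°A₃ + A₁A₃° in End ℂ[M_(m×k)(F_p)], a separating functional Φ(T) =
tr(TQ) sought among frame-vs-flag incidence operators; k = 4 (GL_22, V ≈ p^239 vs B₃ ≈ p^238) ⇒ ω ≤
2.4, k = 6 ⇒ 2.25, k-family ⇒ crux. Positive datum: (S₁U⁻, 1, U⁺) IS rank-1-separated in GL_2(F_p)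
for every p (Gauss sums); negative datum: the prime-field frontier triple (Aff⁺, T₂, U⁻) is NOT (kit
j008119: every target fails, rank π₁(S) = W−3, W−7 at p = 3, 5). Why it might fail: big-cell
permutation operators tend to be linearly DEPENDENT in ℂ[Ω_k] (the identity test is one linear
condition against ≈ D^(3/2)/p products in a D-dimensional algebra); subgroup designs are impossible
at m = 2 (V ≤ |G| < B₃) and NormalizerBarrier applies verbatim; H₂'s mixed irreducibles may fail
(N). [CohnUmans2003, BlasiakCohnGrochowPrattUmans2023, BlasiakCohnGrochowPrattUmans2024]
#7 LevelOneGL2Designs (crux, NEW rev 7, L/XL; universality cell) — ∃ c > 0, for unboundedly many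
primes p, rank-1-separated X,Y,Z ⊆ GL_2(F_p) with |X|,|Y|,|Z| ≥ c·p^(3/2); ⇒ #5 by LevelOneLink
(PROVED modulo the Mackey bound Σᶠ_(Irr∩F_1) χ(1)^s ≤ 1 + p^s + (p−2)(p+1)^s, Irr ∩ F_1 = {1, St,
π(θ,1)}). Attack: tests are sums Σ_u Φ_u(g·u) of functions of ONE matrix–vector product, W =
p³+p²−3p−1 exactly (kit-verified p = 3, 5); separation ⇔ TPP' ∧ mono(g₀) ∉ span_ℚ{mono(g) : g ∈
P∖g₀} (ℂ[F_p^×]-monomial matrices on P¹), so candidates are machine-checkable for p ≤ 13; hosts of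
p^(3/2)-pieces = thinned Borels and tori, TPP/separation become sum-product statements about A·B ⊆
F_p; first lemma = the Gauss-sum separation of (S₁U⁻, 1, U⁺) and LieRankDesigns_of_levelOneGL2. Why
it might fail: V ≈ p^4.5 = |G|^(9/8) exceeds every prime-field TPP construction (parabolic triples
tie B₃ at p⁴; CU2003 Prop 11 needs F_(q²)); |U(P)| ≥ |P| − W forces either a quadruple-product set
of size O(W) — near-Borel by Helfgott growth, where toral TPP caps V ≤ p⁴ — or rigid internal
relations; greedy oracle growth reaches only thin designs (|Y| ≤ 2 at p = 3, 5). [CohnUmans2003,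
Helfgott2008, BlasiakCohnGrochowPrattUmans2024]
#9 supports (ledger 2026-08-16T06Z): PROVED and closed — TokenBudget (EFP Thm 7), TokenWall (|X||Y|
≤ Σ_(μ₁≥n−k) f_μ²), SepImpliesTPP, SnEngineLink, LieEngineLink, SubgroupIdentityLink, Assembly; OPEN
— LevelOneLink (M: needs the GL_2 level-one budget Σᶠ_(Irr∩F_1) χ(1)^s ≤ 1 + p^s + (p−2)(p+1)^s via
the tree's block/character machinery; Theorems/LevelGradedCohnUmansLevelOneLinkPermModule.lean is
its first landed piece).
EX-ITEM (dropped 2026-08-16 by the unused-crux route-repair; NOT refuted, NOT a hypothesis of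
closes): LieRankBeatsCubes (stmt-14057, crux r3 at rev 6–9) — one prime p, m, k and a
rank-≤k-separated triple in GL_m(F_p) with Σ_(Irr ∩ F_k) χ(1)³ < |X||Y||Z| (first graded design with
J ≠ ℂ^G beating its own budget; ω < 3 under the radar via #2). It is the ε = 1 slice of #5 up to 2+1
= 3 and V^1 = V (refuter-checked lieRankDesigns_at_one_iff, lieRankBeatsCubes_of_lieRankDesigns,
evidence W.lean of stmt-14057): NECESSARY for #5 (hence for #6, #7 through the proved links), never
sufficient for a hypothesis of closes — a fixed-exponent design certifies only its own exponent s*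
(tensor powers of (G, J, X, Y, Z) multiply budget and volume alike; bi-invariant J^⊗N is again a sum
of full blocks), and no bootstrapping 3 ↦ 2+ε is known — so no honest glue item exists and the rung
is pursued INSIDE the #5/#7 crux chains (LevelOneBeatsCubesAt p and
not_levelOneGL2Designs_of_eventually_not_beatsCubes in Cruxes/LevelOneGL2Designs/Disproof.lean; a
certificate lands as a --supports helper of #5/#7). Cells: every rank-1 cell with p ≤ 7 is EMPTY by
the sharp-D graded Neumann count, GL_3(F_2) level 2 empty; first live GL_2(F_11): V ∈ (16884, 21032]
(80 % of cap), GL_2(F_13) (32382, 43960], GL_2(F_17) 64 %, GL_3(F_11) (2.35e7, 2.86e7]; B₃/ψ(D) ≈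
2.6/√p; level 2: GL_7(F_13) with the C_r boost V/B₃ = 1.33 (r = 3), 1.77 (r = 4) inside both Neumann
counts (card punctured-radicals). Standing negative data (Cruxes/LieRankBeatsCubes/Disproof.lean v3,
0 sorry; Theorems/LieRankBeatsCubes/Negative/{BorelSubgroups, TopLevel, LDUFunctional}): k ≥ m ≡ the
full-budget Cohn–Umans problem in GL_m(F_p); the prime-field frontier triple (Aff⁺, T, U⁻), V =
p²(p−1)², has TPP but is NOT rank-1 separated for any odd p (LDU alternating functional), verified
rank-1 designs of that type have V ~ p³. Attack notes kept for the chains: structured search under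
the exact linear oracle (separation ⇔ TPP' ∧ targets avoid U(P), U(P) = ∪ supports of
F_k^⊥-functions inside P = X⁻¹YY⁻¹Z; smallest level-1 obstruction = a toral 2×2 rectangle of
U-cosets inside a Borel coset), max-biclique/ILP over ≈ p³ candidate pairs at p = 11, 13 with Y a
coset segment of the non-split torus; six crux ideas in Cruxes/LieRankBeatsCubes/Ideas/
(interpolation-bases, twisted-box-circuits, equivariant-orbit-designs, punctured-radicals,
gelfand-graev-sector-calculus, host-fourier-support-criterion), LevelOneCensus-ideator2.md,
Ideator1Sketch.lean / Ideator2Sketch.lean, kit jobs j011158/j011161/j011162/j011362 (done),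
j013234/j013238 (cdisprove). [BlasiakCohnGrochowPrattUmans2024, BlasiakCohnGrochowPrattUmans2023,
CohnUmans2003]
TWO-LAYER PLAN. GradedPricing ⇐ no split (line picked, stubs closed). LieRankDesigns ⇐ its
sufficient sharpenings are now SIBLING cruxes with proved links rather than a split (alternatives
are disjunctive): #6 → #5 (SubgroupIdentityLink), #7 → #5 (LevelOneLink); foreseen split of #6 once
a lead picks the template: TemplateTPP_k → TemplateFilterN_k → TemplateIdentityTest_k → #6 (k even ≥
4, m = k²+3k/2; the first two are counting, the third is the mathematics), lab instance k = 2 (m =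
7, 8: ties B₃, decides the mechanism). SnLevelDesigns ⇐ (near-wall family with γ_k ≥ k^(−C)) →
PolySlack glue (VK, proved) → #4; children = the RSS/KL Bruhat-shadow line of the chain. The
exponent-3 rung (ex-item LieRankBeatsCubes) is not an item: one certificate ((2,1) at p = 11, 13,
17, then (3,1), (4,2), (7,2)) lands as a --supports helper of #5/#7.
KILL CRITERIA. Close refuted:GradedDesignFamily if ¬X is proved — candidate: a GRADED PACKING
BARRIER V^(w/3) ≤ Σ_(χ∈J) χ(1)^w for a fixed w > 2 in every finite group (graded Neumann alone is
NOT a kill). Close refuted if BOTH engines die: ¬SnLevelDesigns (a level-uniform token barrier γ_k →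
0 faster than any k^(−C), e.g. the 'Neumann-Y' count |Y|(|X|+|Z|−1) ≤ dim J on all slabs, or
hypercontractive junta structure of separated sets) AND ¬LieRankDesigns (graded mixing V ≲
D^(3/2)/√d_min(R_k), or BCGPU2023 Thm 3.2 extended from volumes to graded budgets) — decisive finite
form: NO rank-≤k-separated triple in any GL_m(F_p) beats the graded sum of cubes (the negation of
#5's ε = 1 slice, ex-item LieRankBeatsCubes; it kills #5 by lieRankBeatsCubes_of_lieRankDesigns,
hence #6 and #7 by the proved links). NOT kills, by design: ¬#6 (subgroups fail, subsets may not;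
then NormalizerBarrier-type knowledge is catalogued and #7 and the subset cells carry the engine),
¬#7 (the (2,1) cell capped at O(p⁴): a new level-1 packing theorem worth cataloguing; engine moves
to (m,1), m ≥ 3, and the template), any single rung (LevelTwoBeatsCubes rev 3; a fixed S_n level; a
fixed Lie cell): each is dropped as a settled negative edge and moves the first rung up (NUMBERS).
¬GradedPricing can only be a rendering defect ⇒ restate. Mooted if ω = 2 lands elsewhere; superseded
by a route filing the general host class 'unit configurations in ⊕M_(d_i) with linear separation'
with a construction.
NOT DECOMPOSED YET. Not items: the Borel template's per-k statements (await a lead's pick; typed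
targets BorelTemplateDesigns224 / BorelTemplateFamily exist in
Cruxes/LieRankDesigns/IdeatorSketch2.lean), the level-one GL_2 budget lemma (rides with LevelOneLink
as a --supports helper), RSS Thm 2 / KL straightening as Literature facts (triage asks to vendor
them; the S_n line's first stubs), the AGL_d(F_q) < S_(q^d) thinning family (dead for d+1 ≤ 7 by
graded Neumann, 4 % slack at 8), Young's rule in equality form, Schensted's count, window constants.
Possible future reshaping (planner note, not done): the S_n engine (#4 +
TokenBudget/TokenWall/SnEngineLink) could become its own route if the Lie side saturates the item
cap. Not an item since the 2026-08-16 unused-crux repair: the exponent-3 milestone LieRankBeatsCubes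
(stmt-14057; see EX-ITEM under RANKED CRUXES — necessary for #5, not sufficient for closes;
re-adding it is one `workitem add` if a planner wants the rung staffed on its own again, at the
price of the same unused-crux flag). No negation items; no definition items (test spaces,
separation, SubgroupTPP by name from the tree).
CHEAPEST FALSIFIER. Ordered by cost. (i) TEMPLATE, p = 2 skeleton (kit j010693, this seat, queued
2026-08-16T02:29Z, evidence → stmt-7614): identity test for (U⁻_(cols 1,2), U⁺_(row 3), U⁺_(rows
1,2)) in GL_4(F_2) at levels 1–3 via the frame Gram matrix K(g) = p^(k·null(g−1)) mod two primes,
plus GL_2/GL_3 level-1 Borel configurations (re-deriving the (S₁U⁻,1,U⁺) ✓ / (Aff⁺,T₂,U⁻) ✗ data and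
job j008501's (U⁻,T,U⁺) question); a NO (Id ∈ span) at GL_4(F_2)/GL_5(F_2) that persists at p = 3 is
strong evidence against the whole template; (ii) (N) for H₂ = S₂⋉U⁺_(rows k+1..2k) on its mixed
irreducibles and pair-injectivity of (H₁,H₃) at k = 2, m = 7 (character arithmetic of pattern
groups, by hand/GAP); (iii) the exponent-3 cells GL_2(F_11), GL_2(F_13) (LevelOneBeatsCubesAt p in
Cruxes/LevelOneGL2Designs/Disproof.lean; seeds must avoid the dead frontier type (Aff⁺, T, U⁻), not
rank-1 separated for any odd p): structured oracle search with Y a non-split-torus coset segment; a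
ratio V_max/ψ(D) visibly decaying in p retires (2,1) at exponent 3, moves the rung to
(3,1)/(4,2)/(7,2) and sends #7 to the barrier side; (iv) S_n: the finite cells the count leaves open
below level 7 — (k,n) = (5,8): D₅(8) = 38 890, B₃ = 2 501 920, cap 2 964 912 (≥ 84 % packing
needed), (5,7), (5,9..11), (6,8..15) — seeded SAT/max-clique with the chain's verify_sep.py; (v)
decisive but not cheap: the Neumann-Y count (0 violations in 30 092 separated triples, n ≤ 5; proof
unknown) caps V ≤ (dim J/2)^(3/2) and kills S_n level 7 too.
NUMBERS. Graded Neumann (tree, every group, one-sided-invariant J): |X||Z| + |X|(|Y|−1) ≤ D and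
|X||Z| + (|Y|−1)|Z| ≤ D ⇒ V ≤ ψ(D) = max_t(tD − t³ + t²) = 0.3849·D^(3/2)(1+o(1)), extremal shape
(t,2t,t); symmetric shapes V ≤ (D/2)^(3/2). Packing law: exponent w needs Σ_R d^w < 0.385^(w/3)(Σ_R
d²)^(w/2), i.e. N_eff > 6.75 at w = 3 and ≈ 3.6^(1/ε) comparable blocks at w = 2+ε. S_n: D_k ≈
n^(2k)/k!, budget_k(3) ≈ r_k n^(3k)(k!)^(−3/2), r_2..r_8 = 0.707, 0.680, 0.544, 0.453, 0.417,
0.3645, 0.313, r_10 = 0.249, r_14 = 0.160: levels 2–6 EMPTY at exponent 3 (level 2 for every n: the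
refutation; n = 3,4,5: V ≤ 8, 54, 325 vs B₃ = 10, 63, 406), level 7 margin 1.056, 8: 1.23, 10: 1.55,
14: 2.40; each fixed k dead for ε < ε_k ≈ 6/k (ε_7 = 0.91, ε_14 = 0.41). Lie rank 1 (D, B₃, ψ(D),
|G|): GL_2(F_p) p = 3: 26, 92, 60, 48; 5: 134, 774, 644, 480; 7: 370, 2904, 2860, 2016; 11: 1418,
16884, 21032, 13200; 13: 2326, 32382, 43960, 26208; 17: 5150, 92394, 143976, 78336; GL_3(F_11):
176626, 2.347e7, 2.863e7, 2.12e9; GL_3(F_2) level 2: 150, 1072, 756. General (m,k): D_k ≈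
p^(2mk−k²), B_s ≈ p^(s(mk−k²/2−k/2)+k), quasirandom cap V ≤ |G|^(3/2)/n(G)^(1/2) + |G| with
n(GL_m(F_p)) = smallest non-linear degree (p−1 at m = 2: cap ≈ p^5.5 ≫ p^4.5 needed); template: |H₁|
= |H₃| = (p−1)^(k/2) p^(km−k(k+1)/2) = √D(1−O(k/p)), r₂ = k² + k/2 − 1 torus dimensions in H₂, V/B₃
≈ p^(k/2−1) (tie at k = 2, win from k = 4), V^(s/3) > B_s ⇔ s > 2 + 4/(3k−2). (2,1): prime-field
frontier (Aff⁺,T,U⁻) V = p²(p−1)² = B₃ − 4p³ + O(p²); CU2003 Prop 10 (held) SL_2(F_q) realises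
⟨q,q,q⟩, Prop 11 ⟨q²,q²,q³−q⟩ in SL_2(F_(q²)), liminf α ≤ 18/7, '< 9/4 answers the fundamental
question'. Full budget: CKSU2005 §2 (C_n³)² ⋊ C_2, ω < 2.9088 at n = 17; S_n threshold
(n!)^(1/2)e^(−o(√n)) (BCCGU2017 §5, held).
DEFINITION REQUESTS. None: k-token space, Fourier-rank space, separation and (rev 7)
SubgroupTPP-by-name stay inlined; all 15 signatures elaborate (Sketch.lean, SketchLinks.lean rc 0,
2026-08-16). Facts that would shorten proofs: RSS2009 Thm 2 + KL cell-ideal triangularity (S_n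
line), the Mackey decomposition of ℂ[F_p²] under GL_2(F_p) (LevelOneLink), Schensted's identity
(TokenWall); BCGPU24 Thm 2.2 itself is GradedPricing (to be PROVED, line picked).

Novelty: Searches (rev 1–6 logs kept: lit read arXiv:2410.14905 Thm 2.2/Def 2.1/p. 4; lit read
arXiv:1011.3342 EFP Thm 7; lit citing 2410.14905 and 2204.03826; lit frontier MatrixMultiplication
--since 2022; zbMATH 'triple product property matrix multiplication' (8, all full-budget) and
'intersecting families of permutations'; galaxy --star all "triple product property" (13: CKSU05,
BCGPU24 LIPIcs, Sawin 1702.00905, Stothers thesis), "separating functions triple product property"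
(0), "Cohn-Umans symmetric group" (0), "small representations of finite classical groups" (0)). NEW
2026-08-16 (promote seat): lit read --grep re-verification in the HELD texts of every statement
quoted — BCGPU24 (2410.14905) Def 2.1 p. 10, Thm 2.2 p. 11 incl. the D·d_max^(ω−2) form,
'conceivable' p. 4, Thm 3.1/Lemma 3.2 pp. 25–27; CU2003 (math/0307321) Prop 10/11, the SL_3(F_2)
unitriangular-conjugates failure, liminf α(SL_2(F_q)) ≤ 18/7 and '< 9/4', Lie pseudo-exponent Thm
12; BCGPU2023 (2204.03826) Thm 3.2 with n(G) = min non-linear degree, Cor 3.4, Thm 3.6; BCCGU2017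
(1712.02302) §5 open question 'all triples of subsets of S_n' and the n!^(1/2)/e^(o(√n)) threshold;
Helfgott2008 (math/0509024) Key Proposition; GurevichHowe2017 (1609.01276) Thm 15 (eta
correspondence), Thm 21 (dimension estimate); RaghavanSamuelSubrahmanyam2009 (0902.2842) Thm 2;
CKSU2005 (math/0511460) §2 'Beating the sum of the cubes', n = 17 ⇒ ω < 2.9088. lit search --hybrid
'triple product property parabolic subgroups GL_n finite field  [refs: 2410.14905, 1011.3342, 2411.15789, 2510.22193, 2307.06463, Helfgott2008, GurevichHowe2017, RaghavanSamuelSubrahmanyam2009, BlasiakCohnGrochowPrattUmans2024, CohnUmans2003, BlasiakCohnGrochowPrattUmans2023, BlasiakChurchCohnGrochowUmans2017, EllisFriedgutPilpel2011]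

Barriers (technique_class: group-theoretic, graded-budget, TPP-subsets, TPP-subgroups): - technique_class: group-theoretic, graded-budget, TPP-subsets, TPP-subgroups
- Literature.Barriers.MatrixMultiplication.QuasirandomBarrier: in scope (SepImpliesTPP puts every
graded design under BCGPU2023_thm32: V ≤ |G|^(3/2)/n(G)^(1/2) + |G|, n(G) = least non-linear degree)
and evaded NUMERICALLY with room: the graded thresholds are D_k^(3/2) ≈ p^(3mk−3k²/2), below the cap
iff (m−k)²/2 > m/6 — at (2,1): need p^4.5, cap ≈ p^5.5; template (22,4): need p^239, cap ≈ p^715;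
Cor 3.4 ('no ω < 2+ε from Lie type') charges the trivial character's main term against the FULL
Σ_Irr d^ω (≈ p^(22+231ω) at m = 22) whereas GradedPricing charges Σ_(F_k) d^s (≈ p^(78s+4)): the
route lives exactly in the gap the barrier's proof leaves; a GRADED mixing lemma (V ≲
D^(3/2)/√d_min(R_k)) is not in the catalogue and is the named candidate kill of the Lie engine.
- Literature.Barriers.MatrixMultiplication.NormalizerBarrier: APPLIES VERBATIM to every witness of
SubgroupIdentityDesigns (#6) and to any subgroup realisation of #3/#5/#7 (tree theorem
SubgroupTPP.normalizer_barrier, instantiated in the planner's Sketch.lean: V ≤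
|G|^(3/2)/(s₁s₂s₃)^(1/4)); since (s₁s₂s₃)^(1/4) ≤ (|G|³/V)^(1/4) the bound never says more than V ≤
|G|, and template volumes sit far below |G| (k = 4: V ≈ p^239 < |G| = p^484; in general W_k^(3/2) <
|G| once m ≥ 2.37k): honoured and vacuous; Cor 3.8 (centre; |Z(GL_m(F_p))| = p−1 = |G|^(o(1)))
likewise. For SUBSET designs (#3, #4, #7) only Rem. 3.7's subset form could apply and is

History (route lifecycle, newest last):
- 2026-08-16T01:34:56Z · BROKEN — LevelTwoBeatsCubes (stmt-MatrixMultiplication-7612, crux) refuted by Summit.MatrixMultiplication.MatrixMultiplication.Theorems.LevelGradedCohnUmansLevelTwoBeatsCubes_refuted @ 82fdab13498c (refuter-cdisprove-stmt-MatrixMultiplication-7612-0)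
- 2026-08-16T01:52:42Z · rev 3: dropped LevelTwoBeatsCubes, KillLinkLevelTwo — repair (rev 3; rev 2 carried only the retriage + novelty + barriers of this same repair): ex-crux #3 LevelTwoBeatsCubes (stmt-7612) refuted-substantive for ever (planner-rfix-MatrixMultiplication-LevelGrade-8a47722a-0)
- 2026-08-16T01:52:43Z · REPAIRED (drop LevelTwoBeatsCubes, KillLinkLevelTwo; add SnEngineLink, LieEngineLink) — back to open: repair (rev 3; rev 2 carried only the retriage + novelty + barriers of this same repair): ex-crux #3 LevelTwoBeatsCubes (stmt-7612) refuted-substantive for ever (planner-rfix-MatrixMultiplication-LevelGrade-8a47722a-0)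
- 2026-08-16T01:56:20Z · rev 4: restated SnEngineLink (stmt-MatrixMultiplication-14049) — repair follow-up (rev 4): restate SnEngineLink 1:1 as `SnLevelDesigns → GradedDesignFamily` — rev 3 rendered the form `TokenBudget → SnLevelDesigns → GradedDesi (planner-rfix-MatrixMultiplication-LevelGrade-8a47722a-0)
- 2026-08-16T04:10:59Z · AUTO-CRUX (backfill): GradedDesignFamily — hypotheses of the deciding theorem that nothing in the route derives are cruxes (operator:999:1085951)
- 2026-08-16T06:24:17Z · rev 10: dropped LieRankBeatsCubes — route-repair (unused-crux): drop LieRankBeatsCubes (stmt-MatrixMultiplication-14057) — NOT refuted. The exponent-3 milestone is the ε = 1 slice of crux LieRankD (planner-rrepair-MatrixMultiplication-LevelGrad-af2f91e5-0)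

sub-problem: MatrixMultiplication · status: open · opened planner-plancard-MatrixMultiplication-MatrixM-0e4586d1-0 2026-08-15T12:12:59Z · rev 10 · ledger route-MatrixMultiplication-LevelGradedCohnUmans
GENERATED by the gate from the ledger (D-0016/17). Provers cite these decls: `theorem foo : Summit.MatrixMultiplication.MatrixMultiplication.Theses.LevelGradedCohnUmans.<Decl> := …` in Summits/MatrixMultiplication/MatrixMultiplication/Theorems/<Name>.lean.
-/

namespace Summit.MatrixMultiplication.MatrixMultiplication.Theses.LevelGradedCohnUmans

open scoped BigOperators Topology Manifold Classical MeasureTheory ProbabilityTheory Matrix InnerProductSpace ComplexConjugate ContinuousMap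
open Filter Set Function TopologicalSpace MeasureTheory

attribute [summit_statement] _root_.MatrixMultiplication

/-- item stmt-MatrixMultiplication-7610 · crux (kind.auto-crux: conjecture-grade) · rank 0 · open · by planner
why it might fail: J-separated ⇒ V ≤ 0.385·(dim J)^(3/2) (graded Neumann, tree): at exponent 2+ε the d²-weighted mean of (d_ρ/√D)^ε over Irr∩J must stay < 0.53, so J needs ≳ e^(1.27/ε) comparable blocks; beating even exponent 3 with a proper J is open (LieRankBeatsCubes).
sources: BlasiakCohnGrochowPrattUmans2024, CohnKleinbergSzegedyUmans2005, BlasiakChurchCohnGrochowUmans2017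
[target] X as in § Thesis: for every ε > 0 a finite group G, a bi-invariant test space J ≤ ℂ^G and a
J-separated triple X,Y,Z with Σ_(χ irreducible, χ ∈ J) χ(1)^(2+ε) < (|X||Y||Z|)^((2+ε)/3). -/
@[route_item "route-MatrixMultiplication-LevelGradedCohnUmans", crux]
def GradedDesignFamily : Prop :=
  ∀ ε : ℝ, 0 < ε → ∃ (G : Type) (_ : Group G) (_ : Fintype G) (J : Submodule ℂ (G → ℂ)) (X Y Z : Finset G), (∀ f ∈ J, ∀ a b : G, (fun g : G => f (a * g * b)) ∈ J) ∧ (∀ x₀ ∈ X, ∀ z₀ ∈ Z, ∃ f ∈ J, ∀ x ∈ X, ∀ y ∈ Y, ∀ y' ∈ Y, ∀ z ∈ Z, (x = x₀ ∧ y = y' ∧ z = z₀ → f (x⁻¹ * y * y'⁻¹ * z) = 1) ∧ (¬ (x = x₀ ∧ y = y' ∧ z = z₀) → f (x⁻¹ * y * y'⁻¹ * z) = 0)) ∧ (∑ᶠ χ ∈ Literature.RepresentationTheory.FiniteGroups.irrChars G ∩ (J : Set (G → ℂ)), (χ 1).re ^ (2 + ε)) < ((X.card * Y.card * Z.card : ℕ)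 : ℝ) ^ ((2 + ε) / 3)

/-- item stmt-MatrixMultiplication-7611 · crux · rank 2 · closed · proved by Summit.MatrixMultiplication.MatrixMultiplication.Theorems.GradedPricing.GradedPricing_of (prover) · by planner
why it might fail: Mathematically BCGPU24 Thm 2.2 with G finite, R_sep = {ρ : χ_ρ ∈ J}; only the rendering can fail ('χ ∈ J' = 'M_ρ ⊆ J' needs bi-invariance; Sep must imply TPP); the picked line fourier-support-repfun has both stubs kernel-checked.
sources: BlasiakCohnGrochowPrattUmans2024, CohnUmans2003, CohnKleinbergSzegedyUmans2005
[crux] the finite-group R_sep form of BCGPU24 Thm 2.2 (card fact (i)/scope lemma): for a finite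
group G, a bi-invariant subspace J of functions G → ℂ and a J-separated triple X,Y,Z ⊆ G,
(|X||Y||Z|)^(ω/3) ≤ Σ_(χ ∈ Irr(G) ∩ J) χ(1)^ω (ω = omega ℂ). Proof route: J^⊥ ⊴ ℂ[G] two-sided,
read-out factors through ℂ[G]/J^⊥ ≅ ⊕_(χ_ρ∈J) M_(d_ρ), so ⟨|X|,|Y|,|Z|⟩ restricts to matMulDirectSum
of the block sizes; then the tensor-power/ε→0 argument of rpow_omega_le_sum_blockDegrees_rpow.
[difficulty: M] -/
@[route_item "route-MatrixMultiplication-LevelGradedCohnUmans", crux]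
def GradedPricing : Prop :=
  ∀ (G : Type) [Group G] [Fintype G] (J : Submodule ℂ (G → ℂ)), (∀ f ∈ J, ∀ a b : G, (fun g : G => f (a * g * b)) ∈ J) → ∀ X Y Z : Finset G, (∀ x₀ ∈ X, ∀ z₀ ∈ Z, ∃ f ∈ J, ∀ x ∈ X, ∀ y ∈ Y, ∀ y' ∈ Y, ∀ z ∈ Z, (x = x₀ ∧ y = y' ∧ z = z₀ → f (x⁻¹ * y * y'⁻¹ * z) = 1) ∧ (¬ (x = x₀ ∧ y = y' ∧ z = z₀) → f (x⁻¹ * y * y'⁻¹ * z) = 0)) → ((X.card * Y.card * Z.card : ℕ) : ℝ) ^ (Literature.Computability.AlgebraicComplexity.omega ℂ / 3) ≤ ∑ᶠ χ ∈ Literature.RepresentationTheory.FiniteGroups.irrChars G ∩ (J : Set (G → ℂ)), (χ 1).re ^ Literature.Computability.AlgebraicComplexity.omega ℂ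

/-- item stmt-MatrixMultiplication-7613 · crux · rank 4 · open · by planner
why it might fail: Graded Neumann empties levels ≤ 6 at exponent 3 and each fixed level for ε < 6/k, so witnesses need k → ∞ with near-extremal graded packings; every naive architecture collapses |Y| (blocking dichotomy, triage r1); at k ≥ n−1 it is BCCGU17 §5's open full-budget problem.
sources: BlasiakChurchCohnGrochowUmans2017, EllisFriedgutPilpel2011, RaghavanSamuelSubrahmanyam2009, VershikKerov1985, BlasiakCohnGrochowPrattUmans2024
[crux] the S_n engine for ω = 2 (card Crux 2): for every ε > 0 there are n, k and a
k-token-separated triple X,Y,Z ⊆ S_n (tests f(g) = Σ_(p : [k]→[n]) c_p(g∘p)) with Σ_(λ ⊢ n, λ₁ ≥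
n−k) f_λ^(2+ε) < (|X||Y||Z|)^((2+ε)/3) (f_λ = numStandardTableaux; asymptotically Γ_k := V/n^k ≥
(k!)^(−1/2) e^(−o(√k)) along k → ∞; candidate: thinned conjugates of AGL_d(F_q) < S_(q^d), k = d+1).
Implies GradedDesignFamily via TokenBudget. [deps: GradedPricing] [difficulty: open-problem] -/
@[route_item "route-MatrixMultiplication-LevelGradedCohnUmans"]
def SnLevelDesigns : Prop :=
  ∀ ε : ℝ, 0 < ε → ∃ (n k : ℕ) (X Y Z : Finset (Equiv.Perm (Fin n))), (∀ x₀ ∈ X, ∀ z₀ ∈ Z, ∃ c : (Fin k → Fin n) → (Fin k → Fin n) → ℂ, ∀ x ∈ X, ∀ y ∈ Y, ∀ y' ∈ Y, ∀ z ∈ Z, (∑ p : Fin k → Fin n, c p (⇑(x⁻¹ * y * y'⁻¹ * z) ∘ p)) = if x = x₀ ∧ y = y' ∧ z = z₀ then 1 else 0) ∧ (∑ μ : Nat.Partition n, if n - k ≤ μ.parts.sup then (Literature.NumberTheory.DiophantineGeometry.numStandardTableaux μ : ℝ) ^ (2 + ε) else 0) < ((X.card * Y.card * Z.card : ℕ)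 : ℝ) ^ ((2 + ε) / 3)

/-- item stmt-MatrixMultiplication-7614 · crux · rank 5 · open · by planner
why it might fail: No level k < m beating even exponent 3 is known; all three walls must saturate at once while BALANCE forbids frame-transitive pieces and LEVEL PINNING forbids p-power losses (V = D^(3/2)p^(−ck) ⇒ only ω ≤ 2+4c/(3−2c)); a graded extension of BCGPU2023 Thm 3.2 would kill it.
sources: BlasiakCohnGrochowPrattUmans2024, BlasiakCohnGrochowPrattUmans2023, GurevichHowe2017, CohnUmans2003
[crux] the Lie-type engine under the quasirandom radar (card Crux 3): for every ε > 0 there are a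
prime p, m, k and X,Y,Z ⊆ GL_m(F_p) separated by tests of Fourier rank ≤ k, f(g) = Σ_(rk M ≤ k) c_M
ψ(tr(Mg)) (ψ = ZMod.stdAddChar), with Σ_(χ ∈ Irr(GL_m(F_p)), χ ∈ F_k) χ(1)^(2+ε) <
(|X||Y||Z|)^((2+ε)/3); first target: transplant BCGPU24 Thm 3.1 (U_n, sizes q^(n²/4−n/4),
border-separating degree O(q)) via Lang's theorem and compute the Fourier rank of its separators
(threshold rank k ≈ 0.29·n). An instance of GradedDesignFamily (F_k is bi-invariant since rk(bMa) =
rk M). [deps: GradedPricing] [difficulty: XL] -/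
@[route_item "route-MatrixMultiplication-LevelGradedCohnUmans"]
def LieRankDesigns : Prop :=
  ∀ ε : ℝ, 0 < ε → ∃ (p : ℕ) (_ : Fact p.Prime) (m k : ℕ) (X Y Z : Finset (Matrix.GeneralLinearGroup (Fin m) (ZMod p))), (∀ x₀ ∈ X, ∀ z₀ ∈ Z, ∃ c : Matrix (Fin m) (Fin m) (ZMod p) → ℂ, (∀ M, k < M.rank → c M = 0) ∧ ∀ x ∈ X, ∀ y ∈ Y, ∀ y' ∈ Y, ∀ z ∈ Z, (∑ M : Matrix (Fin m) (Fin m) (ZMod p), c M * ZMod.stdAddChar (Matrix.trace (M * ((x⁻¹ * y * y'⁻¹ * z : Matrix.GeneralLinearGroup (Fin m) (ZMod p)) : Matrix (Fin m) (Fin m) (ZMod p))))) = if x = x₀ ∧ y = y' ∧ z = z₀ then 1 else 0) ∧ (∑ᶠ χ ∈ Literature.RepresentationTheory.FiniteGroups.irrChars (Matrix.GeneralLinearGroup (Fin m) (ZMod p)) ∩ {f | ∃ c : Matrix (Fin m) (Fin m) (ZMod p) → ℂ, (∀ M, k < M.rank → c M = 0) ∧ ∀ g : Matrix.GeneralLinearGroup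 (Fin m) (ZMod p), f g = ∑ M : Matrix (Fin m) (Fin m) (ZMod p), c M * ZMod.stdAddChar (Matrix.trace (M * (g : Matrix (Fin m) (Fin m) (ZMod p))))}, (χ 1).re ^ (2 + ε)) < ((X.card * Y.card * Z.card : ℕ) : ℝ) ^ ((2 + ε) / 3)

/-- item stmt-MatrixMultiplication-14079 · crux · rank 6 · open · by planner
why it might fail: Big-cell operators π_k(h₁h₂h₃) tend to be linearly dependent in ℂ[Ω_k] ((Aff⁺,T₂,U⁻) fails at every target, rank W−3, W−7 at p = 3, 5); m = 2 is excluded (V ≤ |G| < B₃); H₂'s mixed irreducibles may fail (N); NormalizerBarrier applies verbatim.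
sources: CohnUmans2003, BlasiakCohnGrochowPrattUmans2023, BlasiakCohnGrochowPrattUmans2024, GurevichHowe2017, lean:Literature.Barriers.MatrixMultiplication.SubgroupTPP.normalizer_barrier
[crux] the SUBGROUP / IDENTITY-TEST form of the Lie engine (lever L1, card
borel-configuration-identity-test): for every ε > 0 there are a prime p, m, k and subgroups H₁, H₂,
H₃ ≤ GL_m(F_p) with the tree's SubgroupTPP (Literature.Barriers.MatrixMultiplication.SubgroupTPP, by
name), ONE Fourier-rank-≤k test f (f(g) = Σ_(rk M ≤ k) c_M ψ(tr(Mg))) with f(1) = 1 and f(abc) = 0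
for all a ∈ H₁, b ∈ H₂, c ∈ H₃ with abc ≠ 1, and graded budget Σ_(χ ∈ Irr(GL_m(F_p)) ∩ F_k)
χ(1)^(2+ε) < (|H₁||H₂||H₃|)^((2+ε)/3). Implies LieRankDesigns by SubgroupIdentityLink (PROVED:
bi-invariance of F_k moves every target x₀⁻¹z₀ to the identity). Candidate witnesses = the Borel
template H₁ = S₁⋉U⁻_(cols 1..k), H₂ = S₂⋉U⁺_(rows k+1..2k), H₃ = S₃⋉U⁺_(rows 1..k) in
GL_(k²+3k/2)(F_p), k even ≥ 4 (TPP by LDU + tori; filter (N) by regular frame orbits; walls and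
graded Neumann met at V = Θ(D^(3/2)/p); open: the identity test Id ∉ span π_k(H₁H₂H₃∖1); k = 4 in
GL_22(F_p) ⇒ ω ≤ 2.4, the k-family ⇒ this crux). Why easier than LieRankDesigns: one linear
condition on three EXPLICIT subgroups instead of |X||Z| conditions on three unknown sets; TPP,
walls, (N) are counting; NormalizerBarrier applies verbatim and is vacuous -/
@[route_item "route-MatrixMultiplication-LevelGradedCohnUmans"]
def SubgroupIdentityDesigns : Prop :=
  ∀ ε : ℝ, 0 < ε → ∃ (p : ℕ) (_ : Fact p.Prime) (m k : ℕ) (H₁ H₂ H₃ : Subgroup (Matrix.GeneralLinearGroup (Fin m) (ZMod p))), Literature.Barriers.MatrixMultiplication.SubgroupTPP H₁ H₂ H₃ ∧ (∃ c : Matrix (Fin m) (Fin m) (ZMod p) → ℂ, (∀ M, k < M.rank → c M = 0) ∧ (∑ M : Matrix (Fin m) (Fin m) (ZMod p), c M * ZMod.stdAddChar (Matrix.trace (M * ((1 : Matrix.GeneralLinearGroup (Fin m) (ZMod p)) : Matrix (Fin m) (Fin m) (ZMod p))))) = 1 ∧ ∀ a ∈ H₁, ∀ b ∈ H₂, ∀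 g ∈ H₃, a * b * g ≠ 1 → (∑ M : Matrix (Fin m) (Fin m) (ZMod p), c M * ZMod.stdAddChar (Matrix.trace (M * ((a * b * g : Matrix.GeneralLinearGroup (Fin m) (ZMod p)) : Matrix (Fin m) (Fin m) (ZMod p))))) = 0) ∧ (∑ᶠ χ ∈ Literature.RepresentationTheory.FiniteGroups.irrChars (Matrix.GeneralLinearGroup (Fin m) (ZMod p)) ∩ {f | ∃ c : Matrix (Fin m) (Fin m) (ZMod p) → ℂ, (∀ M, k < M.rank → c M = 0) ∧ ∀ g : Matrix.GeneralLinearGroup (Fin m) (ZMod p), f g = ∑ M : Matrix (Fin m) (Fin m) (ZMod p), c M * ZMod.stdAddChar (Matrix.trace (M * (g : Matrix (Fin m) (Fin m) (ZMod p))))}, (χ 1).re ^ (2 + ε)) < ((Nat.card H₁ * Nat.card H₂ * Nat.card H₃ : ℕ) : ℝ) ^ ((2 + ε) / 3)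

/-- item stmt-MatrixMultiplication-14080 · crux · rank 7 · open · by planner
why it might fail: Needs TPP triples in GL_2(F_p) at V ≈ p^4.5, above every prime-field construction (parabolic triples tie B₃ at p⁴); |U(P)| ≥ |P| − W pushes wall-saturating designs toward small quadruple-product sets, near-Borel by Helfgott growth, where toral TPP caps V ≤ p⁴; greedy search finds only thin designs.
sources: CohnUmans2003, Helfgott2008, BlasiakCohnGrochowPrattUmans2024, BlasiakCohnGrochowPrattUmans2023
[crux] UNIVERSALITY OF THE SMALLEST LIE CELL (lever L2, card fixed-rank-universality-gl2-level-one):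
there is c > 0 such that for unboundedly many primes p there are X, Y, Z ⊆ GL_2(F_p), separated by
tests of Fourier rank ≤ 1 (= sums Σ_u Φ_u(g·u) of functions of ONE matrix–vector product; Irr ∩ F_1
= {1, St, π(θ,1) : θ ≠ 1}, W = dim = p³+p²−3p−1, B_s = 1 + p^s + (p−2)(p+1)^s), with |X|, |Y|, |Z| ≥
c·p^(3/2). Implies LieRankDesigns for EVERY ε by LevelOneLink (the chain's
LieRankDesigns_of_levelOneGL2, kernel-checked, + the Mackey budget bound): at fixed (m,k) the ratio
wall^(s/2)/budget_s grows like N_eff^(s/2−1), N_eff ≈ p, so constant-factor wall saturation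
suffices. A packing problem at V ≈ p^4.5 = |G|^(9/8) in the Borel/torus geometry of GL_2(F_p) with
an exact linear oracle (separation ⇔ TPP' ∧ mono(g₀) ∉ span_ℚ{mono(g) : g ∈ X⁻¹YY⁻¹Z ∖ g₀}, monomial
matrices on P¹(F_p)); its exponent-3 shadow is the (2,1) cell of LieRankBeatsCubes (first live p =
11). Why easier: one explicit group family, one explicit p-dimensional family of tests, closed-form
budget, machine-checkable certificates for p ≤ 13, sum-product tools (thinned Borels A·U, tori)
never pointed at this statement. [dep -/
@[route_item "route-MatrixMultiplication-LevelGradedCohnUmans"]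
def LevelOneGL2Designs : Prop :=
  ∃ c : ℝ, 0 < c ∧ ∀ p₀ : ℕ, ∃ (p : ℕ) (_ : Fact p.Prime), p₀ ≤ p ∧ ∃ X Y Z : Finset (Matrix.GeneralLinearGroup (Fin 2) (ZMod p)), (∀ x₀ ∈ X, ∀ z₀ ∈ Z, ∃ c : Matrix (Fin 2) (Fin 2) (ZMod p) → ℂ, (∀ M, 1 < M.rank → c M = 0) ∧ ∀ x ∈ X, ∀ y ∈ Y, ∀ y' ∈ Y, ∀ z ∈ Z, (∑ M : Matrix (Fin 2) (Fin 2) (ZMod p), c M * ZMod.stdAddChar (Matrix.trace (M * ((x⁻¹ * y * y'⁻¹ * z : Matrix.GeneralLinearGroup (Fin 2) (ZMod p)) : Matrix (Fin 2) (Fin 2) (ZMod p))))) = if x = x₀ ∧ y = y' ∧ z = z₀ then 1 else 0) ∧ c * (p : ℝ) ^ (3 / 2 : ℝ) ≤ X.card ∧ c * (p : ℝ) ^ (3 / 2 : ℝ) ≤ Y.card ∧ c * (p : ℝ) ^ (3 / 2 : ℝ) ≤ Z.card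

/-- item stmt-MatrixMultiplication-14050 · support · rank 9 · closed · proved by Summit.MatrixMultiplication.MatrixMultiplication.Theorems.lieEngineLink_proof @ 88c1cbc97f4a (prover) · by planner
sources: BlasiakCohnGrochowPrattUmans2024, arXiv:1609.01276
[support] the Lie engine is load-bearing: LieRankDesigns → GradedDesignFamily. Take J = F_k := {f |
∃ c : M_m(F_p) → ℂ, (∀ M, k < rk M → c M = 0) ∧ ∀ g, f g = Σ_M c M ψ(tr(M g))} as a Submodule of
functions on GL_m(F_p); F_k is bi-invariant because tr(M·agb) = tr((bMa)·g) and rk(bMa) = rk M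
(reindex M ↦ bMa), the rank-≤k separators are F_k-separators verbatim, and the budget finsum of
LieRankDesigns is literally the one of GradedDesignFamily at J = F_k (same carrier set). [deps:
LieRankDesigns, GradedDesignFamily] [difficulty: provable-now] -/
@[route_item "route-MatrixMultiplication-LevelGradedCohnUmans"]
def LieEngineLink : Prop :=
  LieRankDesigns → GradedDesignFamily

-- earlier SnEngineLink (stmt-MatrixMultiplication-14049, replaced 2026-08-16T01:56:20Z -> stmt-MatrixMultiplication-14051): retired by None — TokenBudget → SnLevelDesigns → GradedDesignFamily
/-- item stmt-MatrixMultiplication-14051 · support · rank 9 · closed · proved by Summit.MatrixMultiplication.MatrixMultiplication.Theorems.snEngineLink_proof @ eba589e1b6d9 (prover) · by planner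
sources: EllisFriedgutPilpel2011, BlasiakCohnGrochowPrattUmans2024
[support] the S_n engine is load-bearing: SnLevelDesigns → GradedDesignFamily. Given ε and the S_n
witness (n, k, X, Y, Z), take G = S_n and J = J_k := {f | ∃ c, ∀ g, f g = Σ_(p : Fin k → Fin n) c p
(g ∘ p)} as a Submodule; J_k is bi-invariant (f(agb) = Σ_p c p (a ∘ g ∘ b ∘ p): reindex p ↦ b ∘ p,
absorb a into c), the k-token separators are J_k-separators verbatim, and the budget Σᶠ_(χ ∈ Irr ∩
J_k) χ(1)^(2+ε) is bounded by the partition sum of SnLevelDesigns using the route item TokenBudget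
at s = 2+ε (prove TokenBudget first, or cite its landed theorem). Stated without the TokenBudget
hypothesis so that the decl does not forward-reference a later item in the rendered file (rev 3
rendered the 3-hypothesis form as a blocked TODO). Replaces the dropped (vacuous) KillLinkLevelTwo
as the S_n-side glue. [deps: SnLevelDesigns, GradedDesignFamily, TokenBudget] [difficulty:
provable-now] -/
@[route_item "route-MatrixMultiplication-LevelGradedCohnUmans"]
def SnEngineLink : Prop :=
  SnLevelDesigns → GradedDesignFamily

/-- item stmt-MatrixMultiplication-14081 · support · rank 9 · closed · proved by Summit.MatrixMultiplication.MatrixMultiplication.Theorems.subgroupIdentityLink_proof @ b89d4aaecdbd (prover) · by planner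
sources: BlasiakCohnGrochowPrattUmans2024, CohnUmans2003
[support] the subgroup engine is load-bearing: SubgroupIdentityDesigns → LieRankDesigns. Given ε and
the witness (p, m, k, H₁, H₂, H₃, TPP, identity test f, budget), take X, Y, Z := the carriers as
Finsets (Finset.univ.filter (· ∈ H_i), card = Nat.card H_i); for the target (x₀, z₀) use the
translate g ↦ f(x₀ g z₀⁻¹), again of Fourier rank ≤ k (reindex M ↦ z₀⁻¹ M x₀, rank preserved), which
on a quadruple reads f(abc) with a = x₀x⁻¹ ∈ H₁, b = yy'⁻¹ ∈ H₂, c = zz₀⁻¹ ∈ H₃, = [abc = 1] = [x =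
x₀ ∧ y = y' ∧ z = z₀] by SubgroupTPP; budget verbatim. PROVED in the planner's SketchLinks.lean
(theorem subgroupIdentityLink_holds, axioms propext/Classical.choice/Quot.sound) from the crux
chain's kernel-checked subgroup_rankSeparated_iff (Cruxes/LieRankDesigns/IdeatorSketch2.lean) — land
by porting ≈ 80 lines into Theorems. [deps: SubgroupIdentityDesigns, LieRankDesigns] [difficulty:
provable-now] -/
@[route_item "route-MatrixMultiplication-LevelGradedCohnUmans"]
def SubgroupIdentityLink : Prop :=
  SubgroupIdentityDesigns → LieRankDesigns

/-- item stmt-MatrixMultiplication-14082 · support · rank 9 · closed · proved by Summit.MatrixMultiplication.MatrixMultiplication.Theorems.levelOneLink_proof (prover) · by planner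
sources: BlasiakCohnGrochowPrattUmans2024, CohnUmans2003
[support] the smallest cell is load-bearing: LevelOneGL2Designs → LieRankDesigns. Two halves: (a)
the ε-bookkeeping LieRankDesigns_of_levelOneGL2 (PROVED in Cruxes/LieRankDesigns/IdeatorSketch2.lean
and re-derived against this decl in the planner's SketchLinks.lean: given ε choose p > max(3,
((2/c)^(2+ε))^(2/ε)) in the family, bound the budget by 1 + p^s + (p−2)(p+1)^s ≤ 2^s p^(1+s), the
volume by (c p^(3/2))³, compare); (b) the GL_2 level-one budget Σᶠ_(χ ∈ Irr(GL_2(F_p)) ∩ F_1) χ(1)^s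
≤ 1 + p^s + (p−2)(p+1)^s for odd p (or any C^s·p^(1+s), which (a) tolerates): every χ ∈ F_1 is a
constituent of the permutation module ℂ[F_p²] = ℂ ⊕ (⊕_θ Ind_B^G(θ ⊗ 1)), so χ(1) ≤ p+1 and Σ χ(1)²
≤ dim F_1 ≤ (p+1)(p²−1)+1 — file (b) as a --supports helper using the tree's block/character
machinery of the GradedPricing line. [deps: LevelOneGL2Designs, LieRankDesigns] [difficulty: M] -/
@[route_item "route-MatrixMultiplication-LevelGradedCohnUmans"]
def LevelOneLink : Prop :=
  LevelOneGL2Designs → LieRankDesigns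

/-- item stmt-MatrixMultiplication-7615 · support · rank 9 · closed · proved by Summit.MatrixMultiplication.MatrixMultiplication.Theorems.tokenBudget_proof (prover) · by planner
sources: EllisFriedgutPilpel2011, JamesLNM682
[support] Young's rule in the direction the pricing needs (EFP Thm 7: V_k = ⊕_(λ ≥ (n−k,1^k)) = span
of k-cosets): every irreducible character of S_n lying in the k-token space J_k is χ_μ with μ₁ ≥
n−k, so for every real s, Σᶠ_(χ ∈ Irr(S_n) ∩ J_k) χ(1)^s ≤ Σ_(μ ⊢ n, n−k ≤ max part) f_μ^s (uses
completeness of the Specht characters, finrank_spechtIdeal = numStandardTableaux, and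
WordIsotypicDominance for 'P_λ kills M^(n−k,1^k) unless λ₁ ≥ n−k'). Glue for SnLevelDesigns →
GradedDesignFamily and for KillLinkLevelTwo. [difficulty: provable-now] -/
@[route_item "route-MatrixMultiplication-LevelGradedCohnUmans"]
def TokenBudget : Prop :=
  ∀ (n k : ℕ) (s : ℝ), (∑ᶠ χ ∈ Literature.RepresentationTheory.FiniteGroups.irrChars (Equiv.Perm (Fin n)) ∩ {f | ∃ c : (Fin k → Fin n) → (Fin k → Fin n) → ℂ, ∀ g : Equiv.Perm (Fin n), f g = ∑ p : Fin k → Fin n, c p (⇑g ∘ p)}, (χ 1).re ^ s) ≤ ∑ μ : Nat.Partition n, if n - k ≤ μ.parts.sup then (Literature.NumberTheory.DiophantineGeometry.numStandardTableaux μ : ℝ) ^ s else 0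

/-- item stmt-MatrixMultiplication-7616 · support · rank 9 · closed · proved by Summit.MatrixMultiplication.MatrixMultiplication.Theorems.tokenWall_proof (prover) · by planner
sources: BlasiakCohnGrochowPrattUmans2024, EllisFriedgutPilpel2011, CohnUmans2003
[support] the upper wall of the level-k window (card check (d)): if X,Y,Z ⊆ S_n are k-token
separated and Z ≠ ∅ then A ↦ π(Â) ∈ ℂ[S_n]/J_k^⊥ is injective, so |X||Y| ≤ dim J_k ≤ Σ_(μ₁ ≥ n−k)
f_μ² (= #{π : lis(π) ≥ n−k} by Schensted); in particular level 1 is empty and level 2 needs |X||Y| ≤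
1+(n−1)²+(n(n−3)/2)²+((n−1)(n−2)/2)². [difficulty: provable-now] -/
@[route_item "route-MatrixMultiplication-LevelGradedCohnUmans"]
def TokenWall : Prop :=
  ∀ (n k : ℕ) (X Y Z : Finset (Equiv.Perm (Fin n))), (∀ x₀ ∈ X, ∀ z₀ ∈ Z, ∃ c : (Fin k → Fin n) → (Fin k → Fin n) → ℂ, ∀ x ∈ X, ∀ y ∈ Y, ∀ y' ∈ Y, ∀ z ∈ Z, (∑ p : Fin k → Fin n, c p (⇑(x⁻¹ * y * y'⁻¹ * z) ∘ p)) = if x = x₀ ∧ y = y' ∧ z = z₀ then 1 else 0) → Z.Nonempty → X.card * Y.card ≤ ∑ μ : Nat.Partition n, if n - k ≤ μ.parts.sup then Literature.NumberTheory.DiophantineGeometry.numStandardTableaux μ ^ 2 else 0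

/-- item stmt-MatrixMultiplication-7618 · support · rank 9 · closed · proved by Summit.MatrixMultiplication.MatrixMultiplication.Theorems.SepImpliesTPP_proof @ 03b56ec51d73 (prover) · by planner
sources: CohnUmans2003, BlasiakCohnGrochowPrattUmans2023
[support] J-separation implies the tree's TripleProductProperty X Y Z (take the target (s,u') and
the quadruple (s',t,t',u)); hence every catalogued TPP volume cap (BCGPU2023_thm32, cor35,
NormalizerBarrier for subgroups) applies to graded designs. Proved in the planner's Sketch.lean
(sorry-free); to be landed in Theorems. [difficulty: provable-now] -/
@[route_item "route-MatrixMultiplication-LevelGradedCohnUmans"]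
def SepImpliesTPP : Prop :=
  ∀ (G : Type) [Group G] (J : Set (G → ℂ)) (X Y Z : Finset G), (∀ x₀ ∈ X, ∀ z₀ ∈ Z, ∃ f ∈ J, ∀ x ∈ X, ∀ y ∈ Y, ∀ y' ∈ Y, ∀ z ∈ Z, (x = x₀ ∧ y = y' ∧ z = z₀ → f (x⁻¹ * y * y'⁻¹ * z) = 1) ∧ (¬ (x = x₀ ∧ y = y' ∧ z = z₀) → f (x⁻¹ * y * y'⁻¹ * z) = 0)) → Literature.Combinatorics.Additive.TripleProductProperty X Y Z

/-- item stmt-MatrixMultiplication-7619 · assembly · rank 1 · closed · proved by Summit.MatrixMultiplication.MatrixMultiplication.Theorems.levelGradedCohnUmans_assembly_proof @ d40345d45b7c (prover) · by planner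
sources: BlasiakCohnGrochowPrattUmans2024, CohnKleinbergSzegedyUmans2005, Blaser2013
[assembly] GradedPricing → GradedDesignFamily → MatrixMultiplication (ω ≤ 2 by the ε := ω − 2
contradiction, plus ω ≥ 2). -/
@[route_item "route-MatrixMultiplication-LevelGradedCohnUmans"]
def Assembly : Prop :=
  GradedPricing → GradedDesignFamily → MatrixMultiplication

-- records of items no longer active in this route (dropped / restated):
-- earlier LevelTwoBeatsCubes (stmt-MatrixMultiplication-7612, dropped 2026-08-16T01:52:42Z): refuted by Summit.MatrixMultiplication.MatrixMultiplication.Theorems.LevelGradedCohnUmansLevelTwoBeatsCubes_refuted @ 82fdab13498c — ∃ (n : ℕ) (X Y Z : Finset (Equiv.Perm (Fin n))), (∀ x₀ ∈ X, ∀ z₀ ∈ Z, ∃ c : (Fin 2 → Fin n) → (Fin 2 → Fin n) → ℂ, ∀ x ∈ X, ∀ y ∈ Y, ∀ y' ∈ Y, ∀ z ∈ Z, (∑ p : Fin 2 → Fin n, c 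

/-! D-0027 §2.1 — DECIDING THEOREM (planner-authored via `route open/edit --closes-file`; by planner-rbadge-MatrixMultiplication-LevelGrade-8a47722a-g2-0 2026-08-15T16:20:25Z):
its hypotheses are this route's items and its conclusion the sub-problem Statement (glue_lint), and it elaborates with this file. -/

/-- Route glue (D-0027 §2.1): the crux `GradedPricing` (the finite-group `R_sep` form of
BCGPU24 Thm 2.2) and the target `GradedDesignFamily` decide the summit `ω(ℂ) = 2`
(`MatrixMultiplication_iff`): `2 ≤ ω(ℂ)` is the proved flattening bound `omega_two_le`
(Literature, FlatteningBound); and if `2 < ω`, feed `ε := ω − 2 > 0` to the design family to get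
a finite group `G`, a bi-invariant test space `J` and a `J`-separated triple `X, Y, Z` with
`Σ_{χ ∈ Irr G ∩ J} χ(1)^ω < (|X||Y||Z|)^(ω/3)`, while the graded pricing of the same triple gives
`(|X||Y||Z|)^(ω/3) ≤ Σ_{χ ∈ Irr G ∩ J} χ(1)^ω` — absurd; hence `ω ≤ 2`. Pure ε-bookkeeping. -/
@[closes "route-MatrixMultiplication-LevelGradedCohnUmans"] theorem closes (hP : GradedPricing) (hX : GradedDesignFamily) : MatrixMultiplication := by
  rw [MatrixMultiplication_iff]
  refine le_antisymm (le_of_not_gt fun hω => ?_)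
    (Literature.Computability.AlgebraicComplexity.omega_two_le ℂ)
  obtain ⟨G, _instG, _instF, J, X, Y, Z, hJ, hsep, hlt⟩ :=
    hX (Literature.Computability.AlgebraicComplexity.omega ℂ - 2) (sub_pos.mpr hω)
  have hle := hP G J hJ X Y Z hsep
  have h2 : (2 : ℝ) + (Literature.Computability.AlgebraicComplexity.omega ℂ - 2)
      = Literature.Computability.AlgebraicComplexity.omega ℂ := by ring
  rw [h2] at hlt
  exact absurd (lt_of_lt_of_le hlt hle) (lt_irrefl _)

end Summit.MatrixMultiplication.MatrixMultiplication.Theses.LevelGradedCohnUmans
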